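/-
Origin: expansion seat `planner-pub-hodgecm-mc-axioms-1-g14-0`, handover #W250 2026-08-20T15:53:55Z md5 bc1504f1dad5 (PKG d73663bad9ef → bc1504f1dad5; 400 l.; MECHANICAL (iib-R) rewrite v3.1 of the PKG file as it stands (39 token edits; rules R1x1+RX[h₂]x38)) (`HOME/mc/pub-hodgecm-mc-axioms-1-g14/revendor/kit-r55/stage55/HodgeCM/Model/Binders/Gen12TorusCurrency.lean`, md5 bc1504f1dad5, 400 lines);
landed by the gen-22 packager (p-g22) in gate run 55 REPLACES the earlier landed copy of `HodgeCM/Model/Binders/Gen12TorusCurrency.lean` (seat copy carried the packager Origin header of an earlier run (stripped)).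
-/
/-
Origin: speedrun cell pub-hodgecm, MODEL-CONSTRUCTION sub-cell, unit pub-hodgecm-mc-binder-1-g6 (BINDER PROVER, gen 6; node
B2-meet = E binders `gen12`/`real34`, sub-item (g1)/(r1) «[T]-currency» of BINDER-OWNERS rows 14/15), seat
prover-pub-hodgecm-mc-binder-1-g6-0, 2026-08-19.
Target in PKG: HodgeCM/Model/Binders/Gen12TorusCurrency.lean (NEW additive leaf; imports `Model/Binders/Gen12Junctions` (kit #2) and
`Model/Sanity/DegenerateCores` (sanity-1, RUN 33: the `kmd` / `thetaModel_ϑ12` unfolding of the END STATE); nothing landed imports it).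
KERNEL ONLY: every declaration below is proved; 0 records, nothing cited, MODEL-N 0.
-/
import Summits.HodgeConjecture.HodgeCM.Model.Binders.Gen12Junctions_2
import Summits.HodgeConjecture.HodgeCM.Model.Sanity.DegenerateCores
import Summits.HodgeConjecture.HodgeCM.PerL34.SeesawFubini

/-!
# [T]-currency: the model generator `ϑ_{T,χ}(Φ)` IS a period over the compact torus quotient `[T] = [U(W₁)] × [U(W₂)]`

The END STATE's (12)-theta lift `(T.t12 V c).ϑ χ Φ ∈ L²([G_U])` is DEFINED (kernel model, pv15 `KernelCarrier`) as the `L²` class of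
`ξ ↦ ∫_{T(𝔸)} β(t) χ(t) θ_Φ(ξ, π (jT t)⁻¹) dν(t)` — an integral over the ADELIC torus `T(𝔸) = SeesawTorus L⁺ L` against its Haar
measure `ν`, cut off by a `T(L₀)`-partition of unity `β` (PerL v5 l. 405 «`∫_{[T]} F = ∫_{T(𝔸)} β F dν`»).  The see-saw identity
(PerL (eq:seesaw), tree `Weil1964/ThetaFormWedgePeriod`, `GelbartRogawski1991/UnitaryDualPairSeesawThetaPeriod`) is a statement about
periods over the COMPACT QUOTIENT `[U(W₁)] × [U(W₂)]` with its probability Haar measure.  This file is the junction between the two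
currencies, for ANY torus side built from a `CompactRest` (so for both `kt12` and `kt34` of the END STATE):

* §1 `CompactRest.ptQ` — the torus points `t ↦ π (jT t)⁻¹ ∈ [U(W)]` DESCEND to `[T]` (`T` is commutative and `jT(T(L₀)) ≤ Γ`);
  `CompactRest.periodIntegrand x Φ ξ ∈ C([T], ℂ)`, `q ↦ χ(q) · θ_Φ(ξ, ptQ q)`;
* §2 **`CompactRest.ϑc_eq_integral_quotient`** — `ϑ_{T,χ}(Φ)(ξ) = ∫_{[T]} χ(q) θ_Φ(ξ, ptQ q) dν_𝓕(q)` for the folded measure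
  `ν_𝓕 = π_*(ν|𝓕_T)` of the PKG fundamental domain `SeesawTorus.fundamentalDomain` (β-unfolding `TorusUnfold.integral_mul_eq_integral_quotient`);
* §3 **`SeesawTorus.map_restrict_fundamentalDomain_eq_smul_probHaarQuot`** — `ν_𝓕 = ν(𝓕_T) • probHaarQuot` (Mathlib's
  `IsFundamentalDomain.QuotientMeasureEqMeasurePreimage_smulHaarMeasure` + `QuotientMeasureEqMeasurePreimage.unique`), hence
  **`CompactRest.ϑc_eq_smul_integral_probHaarQuot`** and, by the PKG Fubini `SeesawFubini.integral_eq_integral_prod`,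
  **`CompactRest.ϑc_eq_smul_integral_prod`**: `ϑ_{T,χ}(Φ)(ξ) = ν(𝓕_T) · ∫_{[U(W₁)]×[U(W₂)]} χ(u₁u₂) θ_Φ(ξ, ptQ(u₁u₂)) d(du₁ du₂)`;
* §4 the END STATE of E at the pin: `pinKt12`/`pinKt34` are such carriers (`rfl`), `(T.t12 V c).ϑ χ Φ = toLp (ϑc χ Φ)` (`rfl`), and the
  kernel under the integral is Weil's `Θ(W.ρ(eV x⁻¹, eW (jT₁₂ t)) Φ)` (`wmOf'_θ_mk`, regime of `U(W)`).

Provenance / use: the [T]-currency half of the junction (J-seesaw) of `Binders/Gen12Junctions` (row `gen12`) and of the (34) see-saw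
inside `QautCore.decomp` (row `real34`).  Nothing here is a claim of the manuscripts under adjudication.
-/

set_option autoImplicit false

noncomputable section

open MeasureTheory NumberField
open scoped InnerProductSpace ENNReal

attribute [-instance] Quotient.instMeasurableSpace

namespace HodgeCM

open HodgeCM.PerL34.N23a HodgeCM.PerL34.Annihilation

namespace Universe

namespace CompactRest

variable {G : Type} [Group G] [TopologicalSpace G] {Γ : Subgroup G} [MeasurableSpace (G ⧸ Γ)] {μQ : Measure (G ⧸ Γ)}
variable {XU : Type} [TopologicalSpace XU]
variable {HG : Type} [NormedAddCommGroup HG] [InnerProductSpace ℂ HG] [CompleteSpace HG]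
variable {SK SigIdxG : Type} [TopologicalSpace SK]
variable {K : KernelCoreCarrier G Γ μQ XU HG SK SigIdxG} {L : Type} [Field L] [NumberField L] [IsCMField L]
  {jT : SeesawTorus (maximalRealSubfield L) L →ₜ* G} (R : CompactRest K L jT)
  (hΛ : SeesawTorus.rat (maximalRealSubfield L) L ≤ Γ.comap jT.toMonoidHom)

local notation3 "L⁺" => maximalRealSubfield L

/-! ## 1. The torus points descend to `[T]` -/

include hΛ in
/-- `t ↦ π (jT t)⁻¹` is constant on `T(L₀)`-cosets (`T` commutative, `jT(T(L₀)) ≤ Γ`). -/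
theorem pt_eq_of_mk_eq {t t' : SeesawTorus L⁺ L}
    (h : (QuotientGroup.mk t : SeesawTorus L⁺ L ⧸ SeesawTorus.rat L⁺ L) = QuotientGroup.mk t') :
    R.kt.pt t = R.kt.pt t' := by
  have hmem : t⁻¹ * t' ∈ SeesawTorus.rat L⁺ L := QuotientGroup.eq.mp h
  have hΓ : jT (t⁻¹ * t') ∈ Γ := hΛ hmem
  rw [KernelTorusCarrier.pt_apply, KernelTorusCarrier.pt_apply, R.kt_jT]
  refine QuotientGroup.eq.mpr ?_
  have hcalc : ((jT t)⁻¹)⁻¹ * (jT t')⁻¹ = jT (t * t'⁻¹) := by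
    rw [inv_inv, map_mul, map_inv]
  rw [hcalc]
  have hcomm : t * t'⁻¹ = (t⁻¹ * t')⁻¹ := by rw [mul_inv_rev, inv_inv, mul_comm]
  rw [hcomm, map_inv]
  exact Γ.inv_mem hΓ

/-- **The torus points of `[U(W)]` read on the compact quotient `[T]`**: `ptQ (tT(L₀)) = π (jT t)⁻¹`. -/
def ptQ : SeesawTorus L⁺ L ⧸ SeesawTorus.rat L⁺ L → G ⧸ Γ :=
  Quotient.lift R.kt.pt fun _ _ hab => R.pt_eq_of_mk_eq hΛ (Quotient.sound hab)

/-- (Ported verbatim from the HodgeCMPerL package; no docstring in the source.) -/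
@[simp] theorem ptQ_mk (t : SeesawTorus L⁺ L) : R.ptQ hΛ (QuotientGroup.mk t) = R.kt.pt t := rfl

/-- (Ported verbatim from the HodgeCMPerL package; no docstring in the source.) -/
theorem ptQ_mk' (t : SeesawTorus L⁺ L) : R.ptQ hΛ (QuotientGroup.mk t) = QuotientGroup.mk (jT t)⁻¹ := by
  rw [ptQ_mk, KernelTorusCarrier.pt_apply, R.kt_jT]

/-- (Ported verbatim from the HodgeCMPerL package; no docstring in the source.) -/
theorem continuous_ptQ [IsTopologicalGroup G] : Continuous (R.ptQ hΛ) := by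
  have h : Continuous R.kt.pt := R.kt.continuous_pt
  exact h.quotient_lift _

/-- **The integrand of the torus period on `[T]`**: `q ↦ χ(q) · θ_Φ(ξ, ptQ q)` (continuous). -/
def periodIntegrand [IsTopologicalGroup G] (x : R.X) (Φ : SK) (ξ : XU) : C(SeesawTorus L⁺ L ⧸ SeesawTorus.rat L⁺ L, ℂ) where
  toFun q := dualChar (R.emb x) q * K.θ Φ (ξ, R.ptQ hΛ q)
  continuous_toFun :=
    (continuous_dualChar (R.emb x)).mul ((K.θ Φ).continuous.comp (continuous_const.prodMk (R.continuous_ptQ hΛ)))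

/-- (Ported verbatim from the HodgeCMPerL package; no docstring in the source.) -/
@[simp] theorem periodIntegrand_apply [IsTopologicalGroup G] (x : R.X) (Φ : SK) (ξ : XU)
    (q : SeesawTorus L⁺ L ⧸ SeesawTorus.rat L⁺ L) :
    R.periodIntegrand hΛ x Φ ξ q = dualChar (R.emb x) q * K.θ Φ (ξ, R.ptQ hΛ q) := rfl

/-- (Ported verbatim from the HodgeCMPerL package; no docstring in the source.) -/
theorem periodIntegrand_mk [IsTopologicalGroup G] (x : R.X) (Φ : SK) (ξ : XU) (t : SeesawTorus L⁺ L) :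
    R.periodIntegrand hΛ x Φ ξ (QuotientGroup.mk t) = R.χv x t * K.θ Φ (ξ, R.kt.pt t) := by
  rw [periodIntegrand_apply, R.emb_spec x t, ptQ_mk]


/-! ## 2. β-unfolding: `ϑ_{T,χ}(Φ)(ξ)` is an integral over `[T]` for the folded measure `π_*(ν|𝓕_T)` -/

/-- The integrand of `ϑc` (kernel model) is the descended integrand times the partition of unity. -/
theorem ϑc_integrand_eq [IsTopologicalGroup G] (x : R.X) (Φ : SK) (ξ : XU) (t : SeesawTorus L⁺ L) :
    wt R.kt.β (R.kt.χv x) t * K.θ Φ (ξ, R.kt.pt t) =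
      R.periodIntegrand hΛ x Φ ξ (QuotientGroup.mk t) *
        ((LatticePU.beta (SeesawTorus.rat L⁺ L) t : ℝ) : ℂ) := by
  rw [periodIntegrand_mk, R.kt_β, wt]
  ring

/-- **`ϑ_{T,χ}(Φ)(ξ) = ∫_{[T]} χ(q) θ_Φ(ξ, ptQ q) dν_𝓕(q)`**, `ν_𝓕 = π_*(ν_T|𝓕_T)` the folded Haar measure of the PKG fundamental
domain `SeesawTorus.fundamentalDomain` (β-unfolding, PerL v5 l. 405). -/
theorem ϑc_eq_integral_quotient [IsTopologicalGroup G] [CompactSpace XU] (x : R.X) (Φ : SK) (ξ : XU) :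
    R.kt.ϑc x Φ ξ =
      ∫ q, R.periodIntegrand hΛ x Φ ξ q
        ∂(Measure.map (QuotientGroup.mk : SeesawTorus L⁺ L → SeesawTorus L⁺ L ⧸ SeesawTorus.rat L⁺ L)
          ((SeesawTorus.haar L⁺ L).restrict (SeesawTorus.fundamentalDomain L⁺ L))) := by
  haveI : IsFiniteMeasureOnCompacts R.kt.ν := R.isFiniteMeasureOnCompacts_kt_ν
  rw [KernelTorusCarrier.ϑc_apply]
  simp_rw [R.ϑc_integrand_eq hΛ x Φ ξ]
  have hβc : Continuous fun t : SeesawTorus L⁺ L => ((LatticePU.beta (SeesawTorus.rat L⁺ L) t : ℝ) : ℂ) :=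
    Complex.continuous_ofReal.comp (LatticePU.beta (SeesawTorus.rat L⁺ L)).continuous
  have hβs : HasCompactSupport fun t : SeesawTorus L⁺ L => ((LatticePU.beta (SeesawTorus.rat L⁺ L) t : ℝ) : ℂ) :=
    (LatticePU.beta (SeesawTorus.rat L⁺ L)).hasCompactSupport.comp_left Complex.ofReal_zero
  exact TorusUnfold.integral_mul_eq_integral_quotient (SeesawTorus.isFundamentalDomain_fundamentalDomain L⁺ L)
    (fun t => ((LatticePU.beta (SeesawTorus.rat L⁺ L) t : ℝ) : ℂ)) (hβc.integrable_of_hasCompactSupport hβs)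
    (LatticePU.beta_sum_complex (SeesawTorus.rat L⁺ L)) (R.periodIntegrand hΛ x Φ ξ)
    (R.periodIntegrand hΛ x Φ ξ).continuous.aestronglyMeasurable (TorusUnfold.essSup_enorm_ne_top _ _)


end CompactRest

end Universe

end HodgeCM

/-! ## 3. The folded Haar measure of `[T]` is `ν(𝓕_T) • probHaarQuot` -/

namespace NumberField.SeesawTorus

open scoped Pointwise

variable (K L : Type) [Field K] [Field L] [NumberField L] [Algebra K L] [FiniteDimensional K L]

/-- **The folded Haar measure** `ν_𝓕 := π_*(ν_T|𝓕_T)` of the PKG fundamental domain on `[T] = T(𝔸) ⧸ T(L₀)`. -/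
def foldedHaar : Measure (SeesawTorus K L ⧸ rat K L) :=
  Measure.map (QuotientGroup.mk : SeesawTorus K L → SeesawTorus K L ⧸ rat K L) ((haar K L).restrict (fundamentalDomain K L))

/-- (Ported verbatim from the HodgeCMPerL package; no docstring in the source.) -/
theorem foldedHaar_apply {A : Set (SeesawTorus K L ⧸ rat K L)} (hA : MeasurableSet A) :
    foldedHaar K L A = haar K L ((QuotientGroup.mk ⁻¹' A) ∩ fundamentalDomain K L) := by
  rw [foldedHaar, Measure.map_apply QuotientGroup.continuous_mk.measurable hA,
    Measure.restrict_apply (QuotientGroup.continuous_mk.measurable hA)]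

/-- (Ported verbatim from the HodgeCMPerL package; no docstring in the source.) -/
theorem foldedHaar_univ : foldedHaar K L Set.univ = haar K L (fundamentalDomain K L) := by
  rw [foldedHaar_apply K L MeasurableSet.univ, Set.preimage_univ, Set.univ_inter]

/-- (Ported verbatim from the HodgeCMPerL package; no docstring in the source.) -/
instance isFiniteMeasure_foldedHaar : IsFiniteMeasure (foldedHaar K L) :=
  ⟨by rw [foldedHaar_univ]; exact haar_fundamentalDomain_lt_top K L⟩

/-- A LEFT translate of the fundamental domain is again a fundamental domain for the (right) action of `T(L₀)`. -/
theorem isFundamentalDomain_smul_fundamentalDomain (t₀ : SeesawTorus K L) :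
    IsFundamentalDomain (rat K L).op (t₀ • fundamentalDomain K L) (haar K L) :=
  (isFundamentalDomain_fundamentalDomain K L).smul_of_comm t₀

/-- The preimage in `T(𝔸)` of a subset of `[T]` is invariant under the right action of `T(L₀)`. -/
theorem preimage_mk_invariant (A : Set (SeesawTorus K L ⧸ rat K L)) (g : (rat K L).op) :
    (fun x => g • x) ⁻¹' (QuotientGroup.mk ⁻¹' A : Set (SeesawTorus K L)) = QuotientGroup.mk ⁻¹' A := by
  ext x
  have hu : ((g : (SeesawTorus K L)ᵐᵒᵖ).unop) ∈ rat K L := Subgroup.mem_op.mp g.2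
  have heq : (QuotientGroup.mk (g • x) : SeesawTorus K L ⧸ rat K L) = QuotientGroup.mk x := by
    rw [QuotientGroup.eq, Subgroup.smul_def, MulOpposite.smul_eq_mul_unop]
    have h1 : (x * (g : (SeesawTorus K L)ᵐᵒᵖ).unop)⁻¹ * x = ((g : (SeesawTorus K L)ᵐᵒᵖ).unop)⁻¹ := by
      rw [mul_inv_rev, mul_assoc, inv_mul_cancel, mul_one]
    rw [h1]
    exact (rat K L).inv_mem hu
  simp only [Set.mem_preimage, heq]

/-- **`ν_𝓕` is left-invariant** (left-invariance of `ν_T` + «any two fundamental domains give an invariant set the same mass»). -/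
instance isMulLeftInvariant_foldedHaar : (foldedHaar K L).IsMulLeftInvariant := by
  refine ⟨fun q₀ => ?_⟩
  induction q₀ using QuotientGroup.induction_on with
  | H t₀ =>
    refine Measure.ext fun A hA => ?_
    rw [Measure.map_apply (measurable_const_mul _) hA, foldedHaar_apply K L hA,
      foldedHaar_apply K L (measurable_const_mul _ hA)]
    have hBm : MeasurableSet (QuotientGroup.mk ⁻¹' A : Set (SeesawTorus K L)) := QuotientGroup.continuous_mk.measurable hA
    have hpre : (QuotientGroup.mk ⁻¹' ((fun q => (QuotientGroup.mk t₀ : SeesawTorus K L ⧸ rat K L) * q) ⁻¹' A) :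
          Set (SeesawTorus K L)) = (t₀ * ·) ⁻¹' (QuotientGroup.mk ⁻¹' A) := by
      ext x
      simp only [Set.mem_preimage, QuotientGroup.mk_mul]
    rw [hpre]
    have hset : (t₀ * ·) ⁻¹' (QuotientGroup.mk ⁻¹' A : Set (SeesawTorus K L)) ∩ fundamentalDomain K L =
        (t₀ * ·) ⁻¹' ((QuotientGroup.mk ⁻¹' A) ∩ t₀ • fundamentalDomain K L) := by
      ext x
      simp only [Set.mem_inter_iff, Set.mem_preimage]
      exact and_congr_right fun _ => (Set.smul_mem_smul_set_iff (a := t₀) (x := x)).symm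
    rw [hset, measure_preimage_mul]
    exact (isFundamentalDomain_smul_fundamentalDomain K L t₀).measure_set_eq
      (isFundamentalDomain_fundamentalDomain K L) hBm (preimage_mk_invariant K L A)

/-- **`ν_𝓕 = ν_T(𝓕_T) • dt`**: the folded Haar measure is the probability Haar measure of `[T]` scaled by the covolume
(uniqueness of Haar measure on the second-countable compact group `[T]`). -/
theorem foldedHaar_eq_smul_probHaarQuot : foldedHaar K L = haar K L (fundamentalDomain K L) • probHaarQuot K L := by
  have h := Measure.haarMeasure_unique (foldedHaar K L) (⊤ : TopologicalSpace.PositiveCompacts (SeesawTorus K L ⧸ rat K L))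
  rw [TopologicalSpace.PositiveCompacts.coe_top, foldedHaar_univ] at h
  exact h

end NumberField.SeesawTorus

/-! ## 4. `ϑ_{T,χ}(Φ)` over the probability Haar measure of `[T]` and over `[U(W₁)] × [U(W₂)]` -/

namespace HodgeCM.Universe.CompactRest

open HodgeCM HodgeCM.PerL34.N23a HodgeCM.PerL34.Annihilation

variable {G : Type} [Group G] [TopologicalSpace G] {Γ : Subgroup G} [MeasurableSpace (G ⧸ Γ)] {μQ : Measure (G ⧸ Γ)}
variable {XU : Type} [TopologicalSpace XU]
variable {HG : Type} [NormedAddCommGroup HG] [InnerProductSpace ℂ HG] [CompleteSpace HG]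
variable {SK SigIdxG : Type} [TopologicalSpace SK]
variable {K : KernelCoreCarrier G Γ μQ XU HG SK SigIdxG} {L : Type} [Field L] [NumberField L] [IsCMField L]
  {jT : SeesawTorus (maximalRealSubfield L) L →ₜ* G} (R : CompactRest K L jT)
  (hΛ : SeesawTorus.rat (maximalRealSubfield L) L ≤ Γ.comap jT.toMonoidHom)

local notation3 "L⁺" => maximalRealSubfield L

/-- **`ϑ_{T,χ}(Φ)(ξ) = ν_T(𝓕_T) • ∫_{[T]} χ(q) θ_Φ(ξ, ptQ q) dq`** (`dq` = the probability Haar measure `probHaarQuot`). -/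
theorem ϑc_eq_smul_integral_probHaarQuot [IsTopologicalGroup G] [CompactSpace XU] (x : R.X) (Φ : SK) (ξ : XU) :
    R.kt.ϑc x Φ ξ =
      (SeesawTorus.haar L⁺ L (SeesawTorus.fundamentalDomain L⁺ L)).toReal •
        ∫ q, R.periodIntegrand hΛ x Φ ξ q ∂(SeesawTorus.probHaarQuot L⁺ L) := by
  rw [R.ϑc_eq_integral_quotient hΛ, show Measure.map (QuotientGroup.mk : SeesawTorus L⁺ L → SeesawTorus L⁺ L ⧸ SeesawTorus.rat L⁺ L)
      ((SeesawTorus.haar L⁺ L).restrict (SeesawTorus.fundamentalDomain L⁺ L)) = SeesawTorus.foldedHaar L⁺ L from rfl,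
    SeesawTorus.foldedHaar_eq_smul_probHaarQuot, integral_smul_measure]

/-- **`ϑ_{T,χ}(Φ)(ξ) = ν_T(𝓕_T) • ∫_{[U(W₁)] × [U(W₂)]} χ(u₁u₂) θ_Φ(ξ, ptQ(u₁u₂)) d(du₁ du₂)`** — the currency of the see-saw
identity (PerL (eq:seesaw): the torus period as an iterated period over the two compact line quotients; PKG
`SeesawTorus.integral_eq_integral_prod`). -/
theorem ϑc_eq_smul_integral_prod [IsTopologicalGroup G] [CompactSpace XU] (x : R.X) (Φ : SK) (ξ : XU) :
    R.kt.ϑc x Φ ξ =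
      (SeesawTorus.haar L⁺ L (SeesawTorus.fundamentalDomain L⁺ L)).toReal •
        ∫ p : (relNormOneIdeles L⁺ L ⧸ relNormOneRat L⁺ L) × (relNormOneIdeles L⁺ L ⧸ relNormOneRat L⁺ L),
          R.periodIntegrand hΛ x Φ ξ (SeesawTorus.quotInl L⁺ L p.1 * SeesawTorus.quotInr L⁺ L p.2)
            ∂((probHaarRelNormOneQuot L⁺ L).prod (probHaarRelNormOneQuot L⁺ L)) := by
  rw [R.ϑc_eq_smul_integral_probHaarQuot hΛ, SeesawTorus.integral_eq_integral_prod]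

omit [IsCMField L] in
/-- The covolume constant is non-zero (the fundamental domain of a lattice has positive Haar measure). -/
theorem haar_fundamentalDomain_toReal_ne_zero :
    (SeesawTorus.haar L⁺ L (SeesawTorus.fundamentalDomain L⁺ L)).toReal ≠ 0 := by
  rw [ENNReal.toReal_ne_zero]
  refine ⟨?_, (SeesawTorus.haar_fundamentalDomain_lt_top L⁺ L).ne⟩
  intro h0
  have h := SeesawTorus.foldedHaar_eq_smul_probHaarQuot L⁺ L
  rw [h0, zero_smul] at h
  have h1 : SeesawTorus.foldedHaar L⁺ L Set.univ = 0 := by rw [h]; rfl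
  rw [SeesawTorus.foldedHaar_univ] at h1
  -- `𝓕_T` has positive measure: `ν_T` is open-positive and `T(L₀) · 𝓕_T` covers `T(𝔸)`
  have hcov := (SeesawTorus.isFundamentalDomain_fundamentalDomain L⁺ L).measure_zero_of_invariant Set.univ
    (fun _ => Set.smul_set_univ) (by rw [Set.univ_inter]; exact h1)
  exact (NeZero.ne (SeesawTorus.haar L⁺ L Set.univ)) hcov

end HodgeCM.Universe.CompactRest

/-! ## 5. The END STATE of E at the pin -/

namespace HodgeCM.Model

open HodgeCM HodgeCM.Universe HodgeCM.PerL34.N23a HodgeCM.PerL34.Annihilation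
open HodgeCM.Universe (AdelicThetaCore AdelicThetaCore₀ SideData ThetaModel)
open Literature.AlgebraicGeometry.HodgeTheory
open Literature.NumberTheory.Automorphic.PicardCM
open Literature.NumberTheory.Transcendental (Arapura2012_Cor_15_4_6)

variable (hHD : exists_isReal_hodgeModel) (hI : hodgePQ_independent_of_hodgeModel)
  (h₁ : BallQuotientUniformised)  (h₃ : CMAbelianVarietyRealised)
variable (h : Bool) (hA : Arapura2012_Cor_15_4_6)
  (W : ∀ {L : CMField} {ι₁ : L →+* ℂ} (V : HermSpace3 L ι₁) (c : SeesawCtx L), WmInput V c.D)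
  (S : ∀ {L : CMField} {ι₁ : L →+* ℂ} (V : HermSpace3 L ι₁) (c : SeesawCtx L), ThetaAdelicSide V c)
  (μ : ∀ {L : CMField}, SeesawCtx L → Fin 4 → InfinitePlace L → ℤ)

/-- The core of the pin (`thetaModelOf = (pinC …).thetaModel h (d12Of μ) (d34Of μ)`, `rfl`). -/
abbrev pinC : (picardCMUniverse hHD hI h₁ h₃).AdelicThetaCore₀ :=
  coreOf _ (embOf hHD hI h₁ h₃) (coverOf hHD hI h₁ h₃ hA) (wmOfInput W)
    (thetaOf _ (thetaClassInputOf _ (fun V c => thetaSpaceInputOf hHD hI h₁ h₃ S V c)))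

/-- (Ported verbatim from the HodgeCMPerL package; no docstring in the source.) -/
theorem pinT_eq_thetaModel :
    pinT hHD hI h₁ h₃ h hA W S μ = (pinC hHD hI h₁ h₃ hA W S).thetaModel h (d12Of μ) (d34Of μ) := rfl

variable {L : CMField} {ι₁ : L →+* ℂ} (V : HermSpace3 L ι₁) (c : SeesawCtx L)

local notation3 "L⁺" => maximalRealSubfield (L : Type)

/-- The (12) residual block of the pin's context, as a `CompactRest` (its `kt` IS the END STATE's (12) torus carrier, `rfl`). -/
abbrev pinR12 : ((pinC hHD hI h₁ h₃ hA W S).toCore h).Rest12 V c :=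
  ((pinC hHD hI h₁ h₃ hA W S).toCore h).side12 (d12Of μ) V c

/-- The (34) residual block of the pin's context. -/
abbrev pinR34 : ((pinC hHD hI h₁ h₃ hA W S).toCore h).Rest34 V c :=
  ((pinC hHD hI h₁ h₃ hA W S).toCore h).side34 (d34Of μ) V c

/-- (Ported verbatim from the HodgeCMPerL package; no docstring in the source.) -/
theorem kmd_kt12_eq : ((pinC hHD hI h₁ h₃ hA W S).kmd h (d12Of μ) (d34Of μ)).kt12 V c =
    (pinR12 hHD hI h₁ h₃ h hA W S μ V c).kt := rfl

/-- (Ported verbatim from the HodgeCMPerL package; no docstring in the source.) -/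
theorem kmd_kt34_eq : ((pinC hHD hI h₁ h₃ hA W S).kmd h (d12Of μ) (d34Of μ)).kt34 V c =
    (pinR34 hHD hI h₁ h₃ h hA W S μ V c).kt := rfl

/-- `T(L₀)` lands in the model lattice along `jT₁₂Model` / `jT₃₄Model` (the `hΛ` of §1–§4 at the pin). -/
theorem hΛ₁₂ : SeesawTorus.rat L⁺ L ≤ (c.D.latticeModelW printFact_unitaryCompact_holds).Γ.comap
    (c.D.jT₁₂Model printFact_unitaryCompact_holds).toMonoidHom :=
  c.D.rat_le_comap_jT₁₂Model printFact_unitaryCompact_holds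

/-- (Ported verbatim from the HodgeCMPerL package; no docstring in the source.) -/
theorem hΛ₃₄ : SeesawTorus.rat L⁺ L ≤ (c.D.latticeModelW printFact_unitaryCompact_holds).Γ.comap
    (c.D.jT₃₄Model printFact_unitaryCompact_holds).toMonoidHom :=
  c.D.rat_le_comap_jT₃₄Model printFact_unitaryCompact_holds

/-- **E's (12) generator IS the realised torus period**: `(T.t12 V c).ϑ χ Φ = toLp (ϑc χ Φ)` (kernel model, `rfl`), with
`ϑc χ Φ ξ = ν_T(𝓕_T) • ∫_{[U(W₁)]×[U(W₂)]} χ(u₁u₂) θ_Φ(ξ, ptQ(u₁u₂)) d(du₁ du₂)` (§4 at the (12) block of the pin). -/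
theorem t12_ϑ_eq_toLp (χ : ((pinT hHD hI h₁ h₃ h hA W S μ).t12 V c).X) (Φ : (pinT hHD hI h₁ h₃ h hA W S μ).SK V c) :
    ((pinT hHD hI h₁ h₃ h hA W S μ).t12 V c).ϑ χ Φ =
      ContinuousMap.toLp (E := ℂ) 2 (quotU V).ν ℂ ((pinR12 hHD hI h₁ h₃ h hA W S μ V c).kt.ϑc χ Φ) := rfl

/-- (Ported verbatim from the HodgeCMPerL package; no docstring in the source.) -/
theorem t34_ϑ_eq_toLp (χ : ((pinT hHD hI h₁ h₃ h hA W S μ).t34 V c).X) (Φ : (pinT hHD hI h₁ h₃ h hA W S μ).SK V c) :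
    ((pinT hHD hI h₁ h₃ h hA W S μ).t34 V c).ϑ χ Φ =
      ContinuousMap.toLp (E := ℂ) 2 (quotU V).ν ℂ ((pinR34 hHD hI h₁ h₃ h hA W S μ V c).kt.ϑc χ Φ) := rfl

/-- The (12) torus period of E's generator over `[U(W₁)] × [U(W₂)]` (§4 specialised). -/
theorem t12_ϑc_eq_smul_integral_prod (χ : ((pinT hHD hI h₁ h₃ h hA W S μ).t12 V c).X)
    (Φ : (pinT hHD hI h₁ h₃ h hA W S μ).SK V c) (ξ : (quotU V).G ⧸ (quotU V).Γ) :
    (pinR12 hHD hI h₁ h₃ h hA W S μ V c).kt.ϑc χ Φ ξ =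
      (SeesawTorus.haar L⁺ L (SeesawTorus.fundamentalDomain L⁺ L)).toReal •
        ∫ p : (relNormOneIdeles L⁺ L ⧸ relNormOneRat L⁺ L) × (relNormOneIdeles L⁺ L ⧸ relNormOneRat L⁺ L),
          (pinR12 hHD hI h₁ h₃ h hA W S μ V c).periodIntegrand (hΛ₁₂ c) χ Φ ξ
              (SeesawTorus.quotInl L⁺ L p.1 * SeesawTorus.quotInr L⁺ L p.2)
            ∂((probHaarRelNormOneQuot L⁺ L).prod (probHaarRelNormOneQuot L⁺ L)) :=
  (pinR12 hHD hI h₁ h₃ h hA W S μ V c).ϑc_eq_smul_integral_prod (hΛ₁₂ c) χ Φ ξ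

/-- **The kernel under the integral is Weil's theta distribution of the W-block** (regime of `U(W)`): at `ξ = xΓ_U` and the torus
point `t`, `θ_Φ(ξ, ptQ t) = Θ(W.ρ(eV x⁻¹, eW (jT₁₂ t)) Φ)` (`wmOf'_θ_mk`, `subtype_jT₁₂Model_apply`). -/
theorem periodIntegrand₁₂_mk (hW : IsAnisotropic L c.D.gramW) (χ : ((pinT hHD hI h₁ h₃ h hA W S μ).t12 V c).X)
    (Φ : (pinT hHD hI h₁ h₃ h hA W S μ).SK V c) (x : ↥(Adelic.regimeSubgroup L V.Hm)) (t : SeesawTorus L⁺ L) :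
    (pinR12 hHD hI h₁ h₃ h hA W S μ V c).periodIntegrand (hΛ₁₂ c) χ Φ (QuotientGroup.mk x) (QuotientGroup.mk t) =
      dualChar χ.1 (QuotientGroup.mk t) *
        Literature.NumberTheory.Weil1964.thetaDistLM (W V c).F (W V c).ι
          (((W V c).ρ ((W V c).eV (x : ↥(Adelic.adelicUnitaryGroup L V.Hm))⁻¹, (W V c).eW (c.D.jT₁₂ t)) :
            Module.End ℂ (Literature.NumberTheory.Automorphic.piSchwartzBruhat (W V c).F (W V c).ι)) Φ.1) := by
  rw [CompactRest.periodIntegrand_mk]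
  congr 1
  rw [KernelTorusCarrier.pt_apply, CompactRest.kt_jT]
  have hθ := wmOf'_θ_mk printFact_unitaryCompact_holds (W V c) Φ x ((c.D.jT₁₂Model printFact_unitaryCompact_holds) t)⁻¹
  have hj := StubTree.SeesawDatum.subtype_jT₁₂Model_apply c.D printFact_unitaryCompact_holds hW t
  simp only [Subgroup.coe_subtype] at hj
  rw [Subgroup.coe_inv, inv_inv, hj] at hθ
  exact hθ

/-- The (34) torus period of E's generator `ϑ₃₄(χ, Φ)` over `[U(W₃)] × [U(W₄)]` (§4 specialised to the (34) block). -/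
theorem t34_ϑc_eq_smul_integral_prod (χ : ((pinT hHD hI h₁ h₃ h hA W S μ).t34 V c).X)
    (Φ : (pinT hHD hI h₁ h₃ h hA W S μ).SK V c) (ξ : (quotU V).G ⧸ (quotU V).Γ) :
    (pinR34 hHD hI h₁ h₃ h hA W S μ V c).kt.ϑc χ Φ ξ =
      (SeesawTorus.haar L⁺ L (SeesawTorus.fundamentalDomain L⁺ L)).toReal •
        ∫ p : (relNormOneIdeles L⁺ L ⧸ relNormOneRat L⁺ L) × (relNormOneIdeles L⁺ L ⧸ relNormOneRat L⁺ L),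
          (pinR34 hHD hI h₁ h₃ h hA W S μ V c).periodIntegrand (hΛ₃₄ c) χ Φ ξ
              (SeesawTorus.quotInl L⁺ L p.1 * SeesawTorus.quotInr L⁺ L p.2)
            ∂((probHaarRelNormOneQuot L⁺ L).prod (probHaarRelNormOneQuot L⁺ L)) :=
  (pinR34 hHD hI h₁ h₃ h hA W S μ V c).ϑc_eq_smul_integral_prod (hΛ₃₄ c) χ Φ ξ

/-- The kernel under the (34) integral: at the CONJUGATED torus point `jT₃₄ t = g (u₁ ⊕ u₂) g⁻¹` (`g = c.D.isoGL`),
`θ_Φ(ξ, ptQ t) = Θ(W.ρ(eV x⁻¹, eW (jT₃₄ t)) Φ)` (regime of `U(W)`). -/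
theorem periodIntegrand₃₄_mk (hW : IsAnisotropic L c.D.gramW) (χ : ((pinT hHD hI h₁ h₃ h hA W S μ).t34 V c).X)
    (Φ : (pinT hHD hI h₁ h₃ h hA W S μ).SK V c) (x : ↥(Adelic.regimeSubgroup L V.Hm)) (t : SeesawTorus L⁺ L) :
    (pinR34 hHD hI h₁ h₃ h hA W S μ V c).periodIntegrand (hΛ₃₄ c) χ Φ (QuotientGroup.mk x) (QuotientGroup.mk t) =
      dualChar χ.1 (QuotientGroup.mk t) *
        Literature.NumberTheory.Weil1964.thetaDistLM (W V c).F (W V c).ι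
          (((W V c).ρ ((W V c).eV (x : ↥(Adelic.adelicUnitaryGroup L V.Hm))⁻¹, (W V c).eW (c.D.jT₃₄ t)) :
            Module.End ℂ (Literature.NumberTheory.Automorphic.piSchwartzBruhat (W V c).F (W V c).ι)) Φ.1) := by
  rw [CompactRest.periodIntegrand_mk]
  congr 1
  rw [KernelTorusCarrier.pt_apply, CompactRest.kt_jT]
  have hθ := wmOf'_θ_mk printFact_unitaryCompact_holds (W V c) Φ x ((c.D.jT₃₄Model printFact_unitaryCompact_holds) t)⁻¹
  have hj := StubTree.SeesawDatum.subtype_jT₃₄Model_apply c.D printFact_unitaryCompact_holds hW t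
  simp only [Subgroup.coe_subtype] at hj
  rw [Subgroup.coe_inv, inv_inv, hj] at hθ
  exact hθ

end HodgeCM.Model

end
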